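import Literature.Analysis.FluidPDE.NSBoundedEnergyClassProofs
import Literature.Analysis.FluidPDE.NSSliceTimeContinuityProofs
import Literature.Analysis.FluidPDE.SereginSverakInteriorContinuity
import HarnessLib

/-!
# Interior continuity of bounded Navier–Stokes solutions: the assembly with the discharged ingredients

`Literature.Analysis.FluidPDE.NSBoundedInteriorContinuity` (`FluidPDE/NSBoundedInteriorRegularity`:
Seregin–Šverák 2009, §2 p. 8 — essentially bounded distributional solutions with `L_{3/2}` pressure
are continuous inside) is reduced there (`nsBoundedInteriorContinuity_of`) to three ingredients, two
of which are now theorems of the tree: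

* `NSBoundedEnergyClass_holds` (`FluidPDE/NSBoundedEnergyClassProofs`): bounded solutions are in
  the energy class locally (Seregin 2014, §6.3, Prop. 3.9, Step 1);
* `NSSliceTimeContinuity_holds` (`FluidPDE/NSSliceTimeContinuityProofs`): spatial equicontinuity
  plus the equations give joint continuity (folklore).

This file records the resulting **conditional** theorems, whose only remaining hypothesis is the
pressure-free spatial regularity theorem of Serrin in the form `NSBoundedSpatialHolder`
(Robinson–Rodrigo–Sadowski 2016, Thm. 13.7 with `q = q' = ∞`; decomposed further in
`FluidPDE/NSBoundedSpatialHolder`):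

* `nsBoundedInteriorContinuity_of_spatialHolder : NSBoundedSpatialHolder → NSBoundedInteriorContinuity`;
* `SereginSverak2009.interiorContinuity_of_spatialHolder :
    NSBoundedSpatialHolder → SereginSverak2009.InteriorContinuity` — the trust base of the
  Seregin–Šverák fact `InteriorContinuity` (§4 ¶1, arXiv p. 11) is thereby the single named fact
  `NSBoundedSpatialHolder`.

The unconditional `NSBoundedInteriorContinuity_holds` / `InteriorContinuity_holds` are the same
one-liners with `NSBoundedSpatialHolder_holds` once that fact is discharged (to be appended here).

## References

* G. Seregin, V. Šverák, Comm. PDE 34 (2009) = arXiv:0804.1803, §2 p. 8, §4 ¶1 p. 11, App. II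
  (a21)–(a22). [`SereginSverak2009`]
* J. C. Robinson, J. L. Rodrigo, W. Sadowski, *The three-dimensional Navier–Stokes equations*
  (CUP 2016), Thm. 13.7. [`RobinsonRodrigoSadowskiCUP2016`]
* G. Seregin, *Lecture notes on regularity theory for the Navier–Stokes equations* (2014), §6.3.
  [`Seregin2014`]
-/

namespace Literature.Analysis.FluidPDE

/-- **Interior continuity of bounded solutions, conditional on Serrin's spatial regularity only**:
`NSBoundedSpatialHolder → NSBoundedInteriorContinuity` (the assembly
`nsBoundedInteriorContinuity_of` fed with the discharged `NSBoundedEnergyClass_holds` and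
`NSSliceTimeContinuity_holds`). [cite: SereginSverak2009, §2 p. 8 and App. II (a21)–(a22)] -/
theorem nsBoundedInteriorContinuity_of_spatialHolder (hC1 : NSBoundedSpatialHolder) :
    NSBoundedInteriorContinuity :=
  nsBoundedInteriorContinuity_of NSBoundedEnergyClass_holds hC1 NSSliceTimeContinuity_holds

/-- **Seregin–Šverák 2009, §4 ¶1 (`InteriorContinuity`), conditional on Serrin's spatial
regularity only**: `NSBoundedSpatialHolder → InteriorContinuity`
(`SereginSverak2009.interiorContinuity_of` and `nsBoundedInteriorContinuity_of_spatialHolder`).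
[cite: SereginSverak2009, §4 ¶1 (arXiv p. 11) with §2 p. 8 and App. II (a21)–(a22)] -/
theorem SereginSverak2009.interiorContinuity_of_spatialHolder (hC1 : NSBoundedSpatialHolder) :
    SereginSverak2009.InteriorContinuity :=
  SereginSverak2009.interiorContinuity_of (nsBoundedInteriorContinuity_of_spatialHolder hC1)

end Literature.Analysis.FluidPDE
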